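import Literature.AlgebraicGeometry.Resolution.AlterationsIsNormalFormParts
import Literature.AlgebraicGeometry.Resolution.AlterationsFormalCoordinates
import Mathlib.RingTheory.MvPowerSeries.Rename
import HarnessLib

/-!
# De Jong's alteration theorem: the nodal normal form 3.5 [B3] from 3.3 and "`nᵢ ∈ {0, 1}`"

Topic: `Literature/AlgebraicGeometry/Resolution`. Companion to `AlterationsIsNormalFormParts.lean`,
whose named fact `DeJong1996CodimThreeNodalForm` [B3] renders de Jong 1996, 3.5 with 4.25 (ii):
at a singular closed point `x` of the total space `X` of a pair in Situation 4.23 with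
`codim(Sing(X), X) ≥ 3`, `(𝒪̂_{X,x}, Î_Z) ≅ (k⟦u, v, t₁, …, t_{d-1}⟧/(uv - t₁ ⋯ t_s), (t₁ ⋯ t_r))`,
`2 ≤ s ≤ r ≤ d - 1`. The printed text reaches this in steps which this file separates:

> "3.3. Let us describe the local situation at a point `x ∈ Sing(X)`. Put `s = f(x) ∈ S`. Let
> `A → A' → B` be as in 2.23, and choose an isomorphism `B ≅ A'⟦u, v⟧/(Q - h)`, with `h ∈ A'`
> (2.23). Suppose that `s` lies in the components `D₁, …, D_r` of `D` but not in any other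
> component. Let `tᵢ ∈ 𝒪_{S,s}` be an element such that `V(tᵢ) = Dᵢ ∩ Spec 𝒪_{S,s}`. Note that
> the elements `t₁, …, t_r` form [part of] a regular system of parameters of `𝒪_{S,s}`, hence
> also of `A` and `A'`. … Therefore we see that `h = ε t₁^{n₁} ⋯ t_r^{n_r}`, `ε ∈ (A')^*` with
> `ε ≠ 0` and `Σ nᵢ ≥ 2` (if `Σ nᵢ = 1`, then the point `x` is regular on `X`). We change `Q`
> into `ε⁻¹ Q`. Thus we have `B ≅ A'⟦u, v⟧/(Q - t₁^{n₁} ⋯ t_r^{n_r})`. … Furthermore, in the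
> split case we may assume `A = A'` and `Q(u, v) = uv`, see 2.23." (p. 63) — "3.5. (Local
> description of the case `codim(Sing(X), X) ≥ 3`.) Looking at the equations
> `Q - t₁^{n₁} ⋯ t_r^{n_r}` for a point `x ∈ Sing(X)` as in 3.3, we see that we must have
> `nᵢ ∈ {0, 1}`. Thus `B` looks like `A'⟦u, v⟧/(Q - t₁ ⋯ t_s)` for some `2 ≤ s ≤ r` and `D` at
> `s` is defined by `t₁ ⋯ t_r = 0`." (p. 64) — "(Note that there [4.25] we consider only closed
> points, so that the situation is automatically split.)" (4.24, p. 75)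

* `DeJong1996SemiStableNodalPresentation` — NAMED FACT, **3.3 at a closed singular point** (with
  2.23 in the split case and Cohen's structure theorem `𝒪̂_{Y,y} ≅ k⟦t₁, …, t_{d-1}⟧` for the
  regular base, a regular system of parameters adapted to `D` going to the variables): the
  presentation `𝒪̂_{X,x} ≅ k⟦u, v, t₁, …, t_{d-1}⟧/(uv - ∏ᵢ tᵢ^{nᵢ})` over `𝒪_{Y,f(x)}`, with
  `nᵢ = 0` for the parameters `tᵢ`, `i > r`, not cutting out a component of `D`, and `Σ nᵢ ≥ 2`.
* `DeJong1996SemiStableNodalBoundary` — NAMED FACT, **3.5 "`D` at `s` is defined by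
  `t₁ ⋯ t_r = 0`" with 4.23/4.24** (no section `τᵢ` passes through a singular point): in any
  such presentation the completed ideal of the boundary `Z` is `(t₁ ⋯ t_r)`.
* `DeJong1996CodimThreeExponentsLeOne` — NAMED FACT, **3.5, first sentence**: under
  `codim(Sing(X), X) ≥ 3` every such presentation has `nᵢ ∈ {0, 1}`.
* PROVED: the passage from the three facts to [B3] — the bookkeeping "Thus `B` looks like
  `A'⟦u, v⟧/(Q - t₁ ⋯ t_s)` for some `2 ≤ s ≤ r`": renumbering the parameters `t₁, …, t_r` so
  that the `s = Σ nᵢ` of them occurring in the relation come first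
  (`DeJong1996.exists_perm_fin_adapted`, `DeJong1996.exists_ringEquiv_nodalPowRing`), and the
  assembly `DeJong1996CodimThreeNodalForm.of_presentation_of_boundary_of_exponents`.

The formal models: `DeJong1996.NodalPowRing k m nn = k⟦u, v, t₁, …, t_m⟧/(uv - ∏ᵢ tᵢ^{nnᵢ})`
(`nodalRelationPow`) with boundary `t₁ ⋯ t_r` (`nodalPowBoundary`), next to the models
`DeJong1996.NodalFamilyRing k m s = k⟦u, v, t⟧/(uv - t₁ ⋯ t_s)` of `AlterationsNormalForm.lean`.

## Sources

* A. J. de Jong, *Smoothness, semi-stability and alterations*, Publ. Math. IHÉS 83 (1996) 51–93: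
  2.23 (pp. 61–62), 3.3, 3.5 (pp. 63–64), 4.23–4.25 (p. 75).
* H. Matsumura, *Commutative Ring Theory* (1986), Thm. 29.7 (Cohen structure theorem with a
  regular system of parameters as variables), via `AlterationsFormalCoordinates.lean`.
-/

noncomputable section

open CategoryTheory CategoryTheory.Limits AlgebraicGeometry TopologicalSpace Topology

namespace Literature.AlgebraicGeometry.Resolution

universe u

open IsLocalRing Scheme.IdealSheafData

/-! ## The formal models with exponents -/

namespace DeJong1996

/-- The relation `uv - ∏ᵢ tᵢ^{nnᵢ}` of 3.3 ("`B ≅ A'⟦u, v⟧/(Q - t₁^{n₁} ⋯ t_r^{n_r})`", split case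
`Q = uv`) in `k⟦u, v, t₁, …, t_m⟧ = MvPowerSeries (Fin 2 ⊕ Fin m) k` (`u = inl 0`, `v = inl 1`,
`tᵢ = inr (i - 1)`), the exponent of a parameter not cutting out a component of `D` being `0`.
[cite: DeJong1996, 3.3, p. 63] -/
def nodalRelationPow (k : Type u) [Field k] (m : ℕ) (nn : Fin m → ℕ) :
    MvPowerSeries (Fin 2 ⊕ Fin m) k :=
  MvPowerSeries.X (Sum.inl 0) * MvPowerSeries.X (Sum.inl 1) -
    ∏ i, MvPowerSeries.X (Sum.inr i) ^ nn i

/-- The formal model `k⟦u, v, t₁, …, t_m⟧/(uv - ∏ᵢ tᵢ^{nnᵢ})` of 3.3 at a singular point of the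
total space of a split semi-stable curve over a regular base of dimension `m` over `k`.
[cite: DeJong1996, 3.3, p. 63] -/
abbrev NodalPowRing (k : Type u) [Field k] (m : ℕ) (nn : Fin m → ℕ) : Type u :=
  MvPowerSeries (Fin 2 ⊕ Fin m) k ⧸ Ideal.span {nodalRelationPow k m nn}

/-- The equation `t₁ ⋯ t_r` of the inverse image of `D` in the formal model of 3.3 ("`D` at `s`
is defined by `t₁ ⋯ t_r = 0`", 3.5). [cite: DeJong1996, 3.5, p. 64] -/
def nodalPowBoundary (k : Type u) [Field k] (m : ℕ) (nn : Fin m → ℕ) (r : ℕ) :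
    NodalPowRing k m nn :=
  Ideal.Quotient.mk _ (∏ i ∈ Finset.univ.filter (fun i : Fin m => i.val < r),
    MvPowerSeries.X (Sum.inr i))

end DeJong1996

/-! ## 3.3, the boundary at a singular point, and the first sentence of 3.5 as named facts -/

/-- NAMED FACT — **de Jong 1996, 3.3 at a closed singular point (split case of 2.23, with
Cohen's structure theorem for the base): the presentation
`𝒪̂_{X,x} ≅ k⟦u, v, t₁, …, t_{d-1}⟧/(uv - t₁^{n₁} ⋯ t_r^{n_r})`.** "Let us describe the local
situation at a point `x ∈ Sing(X)`. Put `s = f(x)`. … choose an isomorphism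
`B ≅ A'⟦u, v⟧/(Q - h)`, with `h ∈ A'` (2.23) [`B = 𝒪̂_{X,x}`, `A = 𝒪̂_{S,s}`]. Suppose that `s`
lies in the components `D₁, …, D_r` of `D` but not in any other component. Let
`tᵢ ∈ 𝒪_{S,s}` be an element such that `V(tᵢ) = Dᵢ ∩ Spec 𝒪_{S,s}`. Note that the elements
`t₁, …, t_r` form [part of] a regular system of parameters of `𝒪_{S,s}`, hence also of `A`
and `A'`. … `h = ε t₁^{n₁} ⋯ t_r^{n_r}`, `ε ∈ (A')^*` with `ε ≠ 0` and `Σ nᵢ ≥ 2` (if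
`Σ nᵢ = 1`, then the point `x` is regular on `X`). We change `Q` into `ε⁻¹ Q`. Thus we have
`B ≅ A'⟦u, v⟧/(Q - t₁^{n₁} ⋯ t_r^{n_r})`. … in the split case we may assume `A = A'` and
`Q(u, v) = uv`" (3.3); "there we consider only closed points, so that the situation is
automatically split" (4.24). Rendered for a pair in Situation 4.23 over an algebraically
closed field `k` (`DeJong1996.SemiStablePair f g D τ`) with `dim X = d` (so that the regular
base `Y` has dimension `d - 1` at its closed points, and `A ≅ k⟦t₁, …, t_{d-1}⟧` by Cohen's
structure theorem with the regular system of parameters as variables, Matsumura Thm. 29.7):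
for every closed point `x` with `𝒪_{X,x}` not regular there are `1 ≤ r ≤ d - 1`, generators
`z₁, …, z_{d-1}` of the maximal ideal of `𝒪_{Y,f(x)}` of which the first `r` cut out `D` (the
stalk of the ideal sheaf of the reduced structure on `D` is `(z₁ ⋯ z_r)`), exponents `nnᵢ`
vanishing for `i > r` with `Σ nnᵢ ≥ 2`, and a ring isomorphism
`e : 𝒪̂_{X,x} ≃ k⟦u, v, t₁, …, t_{d-1}⟧/(uv - ∏ᵢ tᵢ^{nnᵢ})` (`DeJong1996.NodalPowRing`) under
which `zᵢ ↦ tᵢ` (through `𝒪_{Y,f(x)} → 𝒪_{X,x} → 𝒪̂_{X,x}`: the isomorphism is one of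
`A`-algebras). Users take `(h : DeJong1996SemiStableNodalPresentation)`; it is the node
carrying 2.23 (the formal structure of an ordinary double point over a complete local base)
and the unique factorisation argument of 3.3. [cite: DeJong1996, 3.3, p. 63] -/
def DeJong1996SemiStableNodalPresentation : Prop :=
  ∀ (k : Type u) [Field k] [IsAlgClosed k] (X Y : Scheme.{u}) (f : X ⟶ Y)
    (g : Y ⟶ Spec (.of k)) (D : Set Y) (n : ℕ) (τ : Fin n → (Y ⟶ X)) (d : ℕ)
    (hS : DeJong1996.SemiStablePair f g D τ), topologicalKrullDim X = d →
      ∀ x : X, IsClosed ({x} : Set X) → ¬ IsRegularLocalRing (X.presheaf.stalk x) →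
        ∃ (r : ℕ) (z : Fin (d - 1) → Y.presheaf.stalk (f.base x)) (nn : Fin (d - 1) → ℕ),
          1 ≤ r ∧ r ≤ d - 1 ∧
          Ideal.span (Set.range z) = maximalIdeal (Y.presheaf.stalk (f.base x)) ∧
          stalkIdeal (vanishingIdeal ⟨D, hS.isStrictNormalCrossingsDivisor.isClosed⟩) (f.base x) =
            Ideal.span {∏ i ∈ Finset.univ.filter (fun i : Fin (d - 1) => i.val < r), z i} ∧
          (∀ i, r ≤ i.val → nn i = 0) ∧ 2 ≤ ∑ i, nn i ∧
          ∃ e : AdicCompletion (maximalIdeal (X.presheaf.stalk x)) (X.presheaf.stalk x) ≃+*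
              DeJong1996.NodalPowRing k (d - 1) nn,
            ∀ i, e (algebraMap _ _ ((f.stalkMap x).hom (z i))) =
              Ideal.Quotient.mk _ (MvPowerSeries.X (Sum.inr i))

/-- NAMED FACT — **de Jong 1996, 3.5 with 4.23/4.24: in the presentation of 3.3 the boundary
`Z` is `t₁ ⋯ t_r = 0`.** "Thus `B` looks like `A'⟦u, v⟧/(Q - t₁ ⋯ t_s)` for some `2 ≤ s ≤ r`
and `D` at `s` is defined by `t₁ ⋯ t_r = 0`" (3.5); "`Z = τ₁(Y) ∪ … ∪ τₙ(Y) ∪ f⁻¹(D)`, where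
`τᵢ` … are mutually disjoint sections into the smooth locus of `f`" (4.23), "(Of course the
sections `τᵢ` still map into the smooth locus of `f` …)" (4.24): no section passes through a
singular point of `X` (the smooth locus of `f` is regular, `Y` being regular), so near such a
point `Z = f⁻¹(D)`, which — `f` being flat with reduced fibres over the reduced `D` — is
reduced, with ideal generated by `t₁ ⋯ t_r`. Rendered for a pair in Situation 4.23 over an
algebraically closed field `k` with `dim X = d`: at a closed point `x` with `𝒪_{X,x}` not
regular, for every `r`, every family
`z₁, …, z_{d-1}` in `𝒪_{Y,f(x)}` whose first `r` members cut out `D` (the stalk of the ideal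
sheaf of the reduced structure on `D` is `(z₁ ⋯ z_r)`), all exponents `nn` and every ring
isomorphism `e : 𝒪̂_{X,x} ≃ k⟦u, v, t₁, …, t_{d-1}⟧/(uv - ∏ᵢ tᵢ^{nnᵢ})` with `zᵢ ↦ tᵢ`, the
completed ideal of (the reduced structure on) `Z = ⋃ᵢ τᵢ(Y) ∪ f⁻¹(D)` goes to `(t₁ ⋯ t_r)`
(`DeJong1996.nodalPowBoundary`). Users take `(h : DeJong1996SemiStableNodalBoundary)`; it
carries "a flat family with reduced fibres over a reduced base is reduced" and the regularity
of the smooth locus. [cite: DeJong1996, 3.5, p. 64] -/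
def DeJong1996SemiStableNodalBoundary : Prop :=
  ∀ (k : Type u) [Field k] [IsAlgClosed k] (X Y : Scheme.{u}) (f : X ⟶ Y)
    (g : Y ⟶ Spec (.of k)) (D : Set Y) (n : ℕ) (τ : Fin n → (Y ⟶ X)) (d : ℕ)
    (hS : DeJong1996.SemiStablePair f g D τ), topologicalKrullDim X = d →
      ∀ x : X, IsClosed ({x} : Set X) → ¬ IsRegularLocalRing (X.presheaf.stalk x) →
        ∀ (r : ℕ) (z : Fin (d - 1) → Y.presheaf.stalk (f.base x)) (nn : Fin (d - 1) → ℕ)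
          (e : AdicCompletion (maximalIdeal (X.presheaf.stalk x)) (X.presheaf.stalk x) ≃+*
            DeJong1996.NodalPowRing k (d - 1) nn),
          stalkIdeal (vanishingIdeal ⟨D, hS.isStrictNormalCrossingsDivisor.isClosed⟩) (f.base x) =
            Ideal.span {∏ i ∈ Finset.univ.filter (fun i : Fin (d - 1) => i.val < r), z i} →
          (∀ i, e (algebraMap _ _ ((f.stalkMap x).hom (z i))) =
              Ideal.Quotient.mk _ (MvPowerSeries.X (Sum.inr i))) →
            ∀ (U : X.affineOpens) (hU : x ∈ (U : X.Opens)),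
              (completedStalkIdeal (vanishingIdeal ⟨DeJong1996.semiStableBoundary f D τ,
                  hS.isClosed_semiStableBoundary⟩) x U hU).map e.toRingHom =
                Ideal.span {DeJong1996.nodalPowBoundary k (d - 1) nn r}

/-- NAMED FACT — **de Jong 1996, 3.5, first sentence: `codim(Sing(X), X) ≥ 3` forces
`nᵢ ∈ {0, 1}`.** "3.5. (Local description of the case `codim(Sing(X), X) ≥ 3`.) Looking at the
equations `Q - t₁^{n₁} ⋯ t_r^{n_r}` for a point `x ∈ Sing(X)` as in 3.3, we see that we must
have `nᵢ ∈ {0, 1}`." (If some `nᵢ ≥ 2`, the total space is singular along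
`u = v = tᵢ = 0`, a locus of codimension `2`: the relation lies in the square of that prime;
the singular locus of the excellent local ring `𝒪_{X,x}` and that of its completion
correspond, EGA IV 7.8.3 (v).) Rendered for a pair in Situation 4.23 over an algebraically
closed field `k` with `codim(Sing(X), X) ≥ 3` (every non-regular point `x'` has
`dim 𝒪_{X,x'} ≥ 3`): at a closed point `x`, every presentation
`𝒪̂_{X,x} ≅ k⟦u, v, t₁, …, t_m⟧/(uv - ∏ᵢ tᵢ^{nnᵢ})` (`DeJong1996.NodalPowRing k m nn`, as
produced by 3.3) has all `nnᵢ ≤ 1`. Users take `(h : DeJong1996CodimThreeExponentsLeOne)`.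
[cite: DeJong1996, 3.5, p. 64] -/
def DeJong1996CodimThreeExponentsLeOne : Prop :=
  ∀ (k : Type u) [Field k] [IsAlgClosed k] (X Y : Scheme.{u}) (f : X ⟶ Y)
    (g : Y ⟶ Spec (.of k)) (D : Set Y) (n : ℕ) (τ : Fin n → (Y ⟶ X)),
    DeJong1996.SemiStablePair f g D τ →
      (∀ x : X, ¬ IsRegularLocalRing (X.presheaf.stalk x) →
          (3 : WithBot ℕ∞) ≤ ringKrullDim (X.presheaf.stalk x)) →
        ∀ (m : ℕ) (nn : Fin m → ℕ) (x : X), IsClosed ({x} : Set X) →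
          Nonempty (AdicCompletion (maximalIdeal (X.presheaf.stalk x)) (X.presheaf.stalk x) ≃+*
              DeJong1996.NodalPowRing k m nn) →
            ∀ i, nn i ≤ 1

/-! ## Renumbering the parameters: "Thus `B` looks like `A'⟦u, v⟧/(Q - t₁ ⋯ t_s)`" -/

namespace DeJong1996

/-- Applying `Equiv.subtypeCongr` at a point satisfying the first predicate. [folklore] -/
theorem subtypeCongr_apply_of_pos {α : Type*} {p q : α → Prop} [DecidablePred p]
    [DecidablePred q] (e : {x // p x} ≃ {x // q x}) (f : {x // ¬p x} ≃ {x // ¬q x}) (a : α)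
    (h : p a) : Equiv.subtypeCongr e f a = e ⟨a, h⟩ := by
  simp [Equiv.subtypeCongr, Equiv.sumCompl_symm_apply_of_pos h]

/-- Applying `Equiv.subtypeCongr` at a point not satisfying the first predicate. [folklore] -/
theorem subtypeCongr_apply_of_neg {α : Type*} {p q : α → Prop} [DecidablePred p]
    [DecidablePred q] (e : {x // p x} ≃ {x // q x}) (f : {x // ¬p x} ≃ {x // ¬q x}) (a : α)
    (h : ¬p a) : Equiv.subtypeCongr e f a = f ⟨a, h⟩ := by
  simp [Equiv.subtypeCongr, Equiv.sumCompl_symm_apply_of_neg h]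

/-- **Renumbering.** For exponents `nnᵢ ∈ {0, 1}` on `Fin m` vanishing from index `r ≤ m` on,
there is a permutation of `Fin m` preserving the block `{i < r}` and carrying the `s` indices
with `nnᵢ = 1` onto `{i < s}`. [folklore] -/
theorem exists_perm_fin_adapted {m r : ℕ} (nn : Fin m → ℕ)
    (hzero : ∀ i, r ≤ i.val → nn i = 0) (hrm : r ≤ m) :
    ∃ σ : Equiv.Perm (Fin m),
      (∀ i, nn i = 1 ↔ (σ i).val < (Finset.univ.filter fun i => nn i = 1).card) ∧
      (∀ i, i.val < r ↔ (σ i).val < r) := by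
  classical
  set s := (Finset.univ.filter fun i => nn i = 1).card with hs_def
  -- indices with `nnᵢ = 1` lie in the block `{i < r}`
  have h1r : ∀ i, nn i = 1 → i.val < r := fun i hi => by
    by_contra h
    rw [hzero i (not_lt.mp h)] at hi
    exact zero_ne_one hi
  have hsr : s ≤ r := by
    calc s ≤ (Finset.univ.filter fun i : Fin m => i.val < r).card :=
          Finset.card_le_card (fun i hi => by
            simp only [Finset.mem_filter, Finset.mem_univ, true_and] at hi ⊢
            exact h1r i hi)
      _ = Fintype.card {i : Fin m // i.val < r} := (Fintype.card_subtype _).symm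
      _ = r := by rw [← Fintype.card_congr (Fin.castLEquiv hrm), Fintype.card_fin]
  have hsm : s ≤ m := hsr.trans hrm
  -- the block `A = {i < r}` and, inside it, the two predicates to be matched
  let A := {i : Fin m // i.val < r}
  let p : A → Prop := fun y => nn y.1 = 1
  let q : A → Prop := fun y => y.1.val < s
  have hcp : Fintype.card {y : A // p y} = s := by
    rw [Fintype.card_congr (Equiv.subtypeSubtypeEquivSubtype (p := fun i : Fin m => i.val < r)
      (q := fun i => nn i = 1) (fun {i} hi => h1r i hi)), Fintype.card_subtype]
  have hcq : Fintype.card {y : A // q y} = s := by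
    rw [Fintype.card_congr (Equiv.subtypeSubtypeEquivSubtype (p := fun i : Fin m => i.val < r)
      (q := fun i : Fin m => i.val < s) (fun {i} hi => lt_of_lt_of_le hi hsr)),
      ← Fintype.card_congr (Fin.castLEquiv hsm), Fintype.card_fin]
  have hcpq : Fintype.card {y : A // p y} = Fintype.card {y : A // q y} := hcp.trans hcq.symm
  have hcpq' : Fintype.card {y : A // ¬p y} = Fintype.card {y : A // ¬q y} := by
    rw [Fintype.card_subtype_compl, Fintype.card_subtype_compl, hcpq]
  let e₁ : {y : A // p y} ≃ {y : A // q y} := Fintype.equivOfCardEq hcpq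
  let e₂ : {y : A // ¬p y} ≃ {y : A // ¬q y} := Fintype.equivOfCardEq hcpq'
  let inner : A ≃ A := Equiv.subtypeCongr e₁ e₂
  let σ : Equiv.Perm (Fin m) :=
    Equiv.subtypeCongr (p := fun i : Fin m => i.val < r) (q := fun i : Fin m => i.val < r)
      inner (Equiv.refl _)
  -- values of `σ`
  have hσA : ∀ (i : Fin m) (hi : i.val < r), σ i = (inner ⟨i, hi⟩).1 := fun i hi =>
    subtypeCongr_apply_of_pos _ _ i hi
  have hσC : ∀ (i : Fin m), ¬ i.val < r → σ i = i := fun i hi => by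
    change Equiv.subtypeCongr _ _ i = i
    rw [subtypeCongr_apply_of_neg _ _ i hi]
    rfl
  refine ⟨σ, fun i => ?_, fun i => ?_⟩
  · by_cases hi : i.val < r
    · rw [hσA i hi]
      by_cases hp : nn i = 1
      · have h := subtypeCongr_apply_of_pos e₁ e₂ ⟨i, hi⟩ hp
        simp only [hp, true_iff]
        change (inner ⟨i, hi⟩).1.val < s
        rw [show inner ⟨i, hi⟩ = (e₁ ⟨⟨i, hi⟩, hp⟩).1 from h]
        exact (e₁ ⟨⟨i, hi⟩, hp⟩).2
      · have h := subtypeCongr_apply_of_neg e₁ e₂ ⟨i, hi⟩ hp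
        simp only [hp, false_iff]
        change ¬ (inner ⟨i, hi⟩).1.val < s
        rw [show inner ⟨i, hi⟩ = (e₂ ⟨⟨i, hi⟩, hp⟩).1 from h]
        exact (e₂ ⟨⟨i, hi⟩, hp⟩).2
    · rw [hσC i hi]
      have h0 : nn i = 0 := hzero i (not_lt.mp hi)
      simp only [h0, zero_ne_one, false_iff, not_lt]
      exact hsr.trans (not_lt.mp hi)
  · by_cases hi : i.val < r
    · rw [hσA i hi]
      simp only [hi, true_iff]
      exact (inner ⟨i, hi⟩).2
    · rw [hσC i hi]

/-- The sum of exponents `nnᵢ ∈ {0, 1}` is the number of indices with `nnᵢ = 1`. [folklore] -/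
theorem sum_eq_card_filter_of_le_one {m : ℕ} (nn : Fin m → ℕ) (hle : ∀ i, nn i ≤ 1) :
    ∑ i, nn i = (Finset.univ.filter fun i => nn i = 1).card := by
  classical
  rw [Finset.card_eq_sum_ones, Finset.sum_filter]
  refine Finset.sum_congr rfl fun i _ => ?_
  rcases Nat.le_one_iff_eq_zero_or_eq_one.mp (hle i) with h | h <;> simp [h]

/-- **"Thus `B` looks like `A'⟦u, v⟧/(Q - t₁ ⋯ t_s)`"**: renumbering the parameters gives a ring
isomorphism `k⟦u, v, t⟧/(uv - ∏ᵢ tᵢ^{nnᵢ}) ≅ k⟦u, v, t⟧/(uv - t₁ ⋯ t_s)`, `s = Σ nnᵢ`, fixing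
the boundary equation `t₁ ⋯ t_r`, when `nnᵢ ∈ {0, 1}` vanishes for `i > r`.
[cite: DeJong1996, 3.5, p. 64] -/
theorem exists_ringEquiv_nodalPowRing (k : Type u) [Field k] {m r : ℕ} (nn : Fin m → ℕ)
    (hle : ∀ i, nn i ≤ 1) (hzero : ∀ i, r ≤ i.val → nn i = 0) (hrm : r ≤ m) :
    ∃ ρ : NodalPowRing k m nn ≃+* NodalFamilyRing k m (∑ i, nn i),
      ρ (nodalPowBoundary k m nn r) = nodalFamilyBoundary k m (∑ i, nn i) r := by
  classical
  obtain ⟨σ, hσ1, hσr⟩ := exists_perm_fin_adapted nn hzero hrm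
  rw [← sum_eq_card_filter_of_le_one nn hle] at hσ1
  set s := ∑ i, nn i with hs
  -- the renumbering of the variables
  let θ : Fin 2 ⊕ Fin m ≃ Fin 2 ⊕ Fin m := Equiv.sumCongr (Equiv.refl (Fin 2)) σ
  let Φ : MvPowerSeries (Fin 2 ⊕ Fin m) k ≃+* MvPowerSeries (Fin 2 ⊕ Fin m) k :=
    (MvPowerSeries.renameEquiv k θ).toRingEquiv
  have hΦX : ∀ j, Φ (MvPowerSeries.X j) = MvPowerSeries.X (θ j) := fun j =>
    show MvPowerSeries.rename θ (MvPowerSeries.X j) = _ from MvPowerSeries.rename_X _ _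
  have hΦu : Φ (MvPowerSeries.X (Sum.inl 0)) = MvPowerSeries.X (Sum.inl 0) := by
    rw [hΦX]; rfl
  have hΦv : Φ (MvPowerSeries.X (Sum.inl 1)) = MvPowerSeries.X (Sum.inl 1) := by
    rw [hΦX]; rfl
  have hΦt : ∀ i, Φ (MvPowerSeries.X (Sum.inr i)) = MvPowerSeries.X (Sum.inr (σ i)) := fun i => by
    rw [hΦX]; rfl
  -- the relation goes to the relation
  have hrel : Φ (nodalRelationPow k m nn) = nodalFamilyRelation k m s := by
    simp only [nodalRelationPow, nodalFamilyRelation, map_sub, map_mul, map_prod, map_pow, hΦu,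
      hΦv, hΦt]
    congr 1
    rw [Finset.prod_filter]
    refine Fintype.prod_equiv σ _ _ fun i => ?_
    by_cases hi : nn i = 1
    · rw [hi, pow_one, if_pos ((hσ1 i).mp hi)]
    · have h0 : nn i = 0 := by
        rcases Nat.le_one_iff_eq_zero_or_eq_one.mp (hle i) with h | h
        · exact h
        · exact absurd h hi
      rw [h0, pow_zero, if_neg (fun h => hi ((hσ1 i).mpr h))]
  -- the boundary goes to the boundary
  have hbdry : Φ (∏ i ∈ Finset.univ.filter (fun i : Fin m => i.val < r),
      MvPowerSeries.X (Sum.inr i)) =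
      ∏ i ∈ Finset.univ.filter (fun i : Fin m => i.val < r), MvPowerSeries.X (Sum.inr i) := by
    rw [map_prod]
    simp only [hΦt]
    exact Finset.prod_equiv σ (fun i => by simpa using hσr i) (fun i _ => rfl)
  have hIJ : Ideal.span {nodalFamilyRelation k m s} =
      (Ideal.span {nodalRelationPow k m nn}).map (Φ : MvPowerSeries (Fin 2 ⊕ Fin m) k →+*
        MvPowerSeries (Fin 2 ⊕ Fin m) k) := by
    rw [Ideal.map_span, Set.image_singleton, RingHom.coe_coe, hrel]
  refine ⟨Ideal.quotientEquiv _ _ Φ hIJ, ?_⟩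
  rw [nodalPowBoundary, Ideal.quotientEquiv_mk, nodalFamilyBoundary, hbdry]

end DeJong1996

/-! ## The assembly of [B3] -/

/-- **de Jong 1996, 3.5 [B3] from 3.3, the boundary, and "`nᵢ ∈ {0, 1}`"**: the presentation
of 3.3 at a closed singular point (`DeJong1996SemiStableNodalPresentation`), in which the
boundary is `t₁ ⋯ t_r = 0` (`DeJong1996SemiStableNodalBoundary`), has exponents `≤ 1` when
`codim(Sing(X), X) ≥ 3` (`DeJong1996CodimThreeExponentsLeOne`); renumbering the parameters so
that the `s = Σ nᵢ ≥ 2` of them occurring in the relation come first (a renumbering inside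
`t₁, …, t_r`, which fixes `t₁ ⋯ t_r`) gives the normal form of 4.25 (ii) with
`2 ≤ s ≤ r ≤ d - 1`. [cite: DeJong1996, 3.5, p. 64] -/
theorem DeJong1996CodimThreeNodalForm.of_presentation_of_boundary_of_exponents
    (h₁ : DeJong1996SemiStableNodalPresentation.{u}) (h₁' : DeJong1996SemiStableNodalBoundary.{u})
    (h₂ : DeJong1996CodimThreeExponentsLeOne.{u}) : DeJong1996CodimThreeNodalForm.{u} := by
  intro k _ _ X Y f g D n τ d hS hcodim hd x hx hreg
  obtain ⟨r, z, nn, h1r, hrd, -, hD, hzero, hsum, e, he⟩ :=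
    h₁ k X Y f g D n τ d hS hd x hx hreg
  have hbdry := h₁' k X Y f g D n τ d hS hd x hx hreg r z nn e hD he
  have hle : ∀ i, nn i ≤ 1 := h₂ k X Y f g D n τ hS hcodim (d - 1) nn x hx ⟨e⟩
  obtain ⟨ρ, hρ⟩ := DeJong1996.exists_ringEquiv_nodalPowRing k nn hle hzero hrd
  -- `s = Σ nnᵢ ≤ r`: the non-zero exponents sit at indices `< r`
  have hsr : ∑ i, nn i ≤ r := by
    classical
    calc ∑ i, nn i = ∑ i ∈ Finset.univ.filter (fun i : Fin (d - 1) => i.val < r), nn i := by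
          rw [Finset.sum_filter]
          refine Finset.sum_congr rfl fun i _ => ?_
          by_cases hi : i.val < r
          · rw [if_pos hi]
          · rw [if_neg hi, hzero i (not_lt.mp hi)]
      _ ≤ ∑ i ∈ Finset.univ.filter (fun i : Fin (d - 1) => i.val < r), 1 :=
          Finset.sum_le_sum fun i _ => hle i
      _ = (Finset.univ.filter (fun i : Fin (d - 1) => i.val < r)).card := by simp
      _ = Fintype.card {i : Fin (d - 1) // i.val < r} := (Fintype.card_subtype _).symm
      _ = r := by rw [← Fintype.card_congr (Fin.castLEquiv hrd), Fintype.card_fin]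
  refine ⟨∑ i, nn i, r, hsum, hsr, hrd, e.trans ρ, fun U hU => ?_⟩
  have hcomp : (e.trans ρ).toRingHom = ρ.toRingHom.comp e.toRingHom := rfl
  rw [hcomp, ← Ideal.map_map, hbdry U hU, Ideal.map_span, Set.image_singleton]
  exact congrArg (fun a => Ideal.span {a}) hρ

end Literature.AlgebraicGeometry.Resolution

end
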